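import Literature.MathematicalPhysics.StatisticalMechanics.MonomerDimerZeros
import HarnessLib

/-!
# The monomer–dimer representation (3.7) and Heilmann–Lieb's theorem for weighted graphs
# (Salmhofer–Seiler, CMP 139 (1991), (3.5)–(3.7), Thm. 3.6; Heilmann–Lieb, CMP 25 (1972), Thms. 4.2–4.6)

Companion of `MonomerDimerZeros`, which proves Salmhofer–Seiler's Theorem 3.6 in "capacity form":
for exponential site and bond data the coefficient extractions `Z(c) = [∏ σ_x^{c_x}] ∏_x e^{a_xσ_x} ∏_b e^{w_b σ_{s b}σ_{t b}}`
(`MonomerDimer.Z`) do not vanish when `w ≥ 0` and `Re a_x > 0` for all `x`.  This file supplies the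
printed combinatorial meaning of the case `c ≡ 1` (p. 403):

  "An allowed dimer configuration is an arrangement of dimers on the bonds of `G` such that no two
  dimers can have a vertex in common … For an allowed dimer configuration `C`, denote
  `D_C = ∏_{i ∈ C} w_i` (3.6) … Thus the expression for the partition function can be restated as a sum
  over all allowed dimer configurations on `G`, `Z_G = ∑_C D_C ∏_{x uncovered} m_x` (3.7), with
  monomers filled in at all those vertices that are not touched by a dimer.  The restriction to allowed
  dimer configurations as well as the filling condition come from the contour integral."

* `MonomerDimer.dimerConfigs s t A` — the allowed dimer configurations inside a vertex set `A`
  (sets of proper bonds with both ends in `A`, pairwise vertex-disjoint); `MonomerDimer.mdSum a w A`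
  — the monomer–dimer partition function (3.7) `∑_C ∏_{b ∈ C} w_b ∏_{x ∈ A uncovered} a_x`;
* `mdSum_rec` — the Heilmann–Lieb recursion (4.11) `Z_G = x_i Z_{G-i} + ∑_{j} W(i,j) Z_{G-i-j}`,
  proved combinatorially (split according to the dimer covering the vertex `z`);
* **`Z_capOne_eq_mdSum`** — (3.7): the contour integral / coefficient extraction at capacity one
  IS the monomer–dimer partition function (both satisfy the recursion with the same initial value);
* **`mdSum_ne_zero_of_re_pos`, `mdSum_ne_zero_of_re_neg`** — Theorem 3.6 verbatim for weighted
  graphs (Heilmann–Lieb Thm. 4.6); **`mdSum_ne_zero_of_norm`** — the bound on the zeros (Thm. 4.3,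
  `|x| < 2√B₁`); **`mdSum_uniform_eq_zero_imp`** — for one common activity `x` (the weighted
  matching polynomial `∑_M w^M x^{|V|-2|M|}`, `μ_w(G, y) = i^{-|V|} Z_G(iy)`): every zero is purely
  imaginary with `|x|² < 4 B₁` — Heilmann–Lieb's real-rootedness of matching polynomials (Thm. 4.2
  with Thm. 4.3), which Mathlib does not have.

Graphs are encoded as in `MonomerDimerZeros`: a finite vertex type `V`, bonds indexed by a finite
type `β` with end points `s t : β → V` (multiple bonds allowed; self-bonds carry no dimer).  Honest
framing: finite combinatorics of weighted graphs; nothing about `β > 0` lattice gauge theory, the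
continuum or the summit's `QCD` conjunct.

## References

* M. Salmhofer, E. Seiler, Commun. Math. Phys. 139 (1991) 395–432: (3.5)–(3.7) p. 403, Thm. 3.6
  p. 407. [SalmhoferSeiler1991]
* O. J. Heilmann, E. H. Lieb, Commun. Math. Phys. 25 (1972) 190–232: (4.11), Thm. 4.2, Thm. 4.3,
  Thm. 4.6, Lemma 4.7. [HeilmannLieb1972]
-/

noncomputable section

open MvPolynomial Finset

namespace Literature.MathematicalPhysics.StatisticalMechanics

namespace MonomerDimer

variable {V β R : Type*} [CommRing R] [DecidableEq V] [Fintype β] [DecidableEq β]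

/-! ### Dimer configurations and the monomer–dimer sum (3.7) -/

/-- The two end points of the bond `b`. [cite: SalmhoferSeiler1991, (3.5)] -/
def ends (s t : β → V) (b : β) : Finset V := {s b, t b}

/-- The bonds that can carry a dimer inside the vertex set `A`: both ends in `A`, not a self-bond.
[cite: SalmhoferSeiler1991, (3.5)–(3.6)] -/
def bondsIn (s t : β → V) (A : Finset V) : Finset β :=
  univ.filter fun b => s b ∈ A ∧ t b ∈ A ∧ s b ≠ t b

/-- "An allowed dimer configuration is an arrangement of dimers on the bonds of `G` such that no two
dimers can have a vertex in common" — inside the vertex set `A`. [cite: SalmhoferSeiler1991, (3.6)] -/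
def dimerConfigs (s t : β → V) (A : Finset V) : Finset (Finset β) :=
  (bondsIn s t A).powerset.filter fun C =>
    (C : Set β).Pairwise fun b b' => Disjoint (ends s t b) (ends s t b')

/-- The vertices touched by the dimers of `C`. [cite: SalmhoferSeiler1991, (3.7)] -/
def covered (s t : β → V) (C : Finset β) : Finset V := C.biUnion (ends s t)

/-- **The monomer–dimer partition function (3.7)** on the vertex set `A`:
`Z_A = ∑_{C allowed} ∏_{b ∈ C} w_b ∏_{x ∈ A uncovered} a_x` (monomer activities `a_x`, dimer weights
`w_b`). [cite: SalmhoferSeiler1991, (3.7)][cite: HeilmannLieb1972, (1.2)] -/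
def mdSum (s t : β → V) (a : V → R) (w : β → R) (A : Finset V) : R :=
  ∑ C ∈ dimerConfigs s t A, (∏ b ∈ C, w b) * ∏ x ∈ A \ covered s t C, a x

variable {s t : β → V}

omit [DecidableEq β] in
/-- Membership in `bondsIn`. [folklore] -/
private theorem mem_bondsIn {A : Finset V} {b : β} :
    b ∈ bondsIn s t A ↔ s b ∈ A ∧ t b ∈ A ∧ s b ≠ t b := by
  simp [bondsIn]

/-- Membership in `dimerConfigs`. [folklore] -/
private theorem mem_dimerConfigs {A : Finset V} {C : Finset β} :
    C ∈ dimerConfigs s t A ↔ C ⊆ bondsIn s t A ∧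
      (C : Set β).Pairwise fun b b' => Disjoint (ends s t b) (ends s t b') := by
  simp [dimerConfigs]

omit [Fintype β] [DecidableEq β] in
/-- Membership in `ends`. [folklore] -/
private theorem mem_ends {b : β} {x : V} : x ∈ ends s t b ↔ x = s b ∨ x = t b := by
  simp [ends]

omit [Fintype β] [DecidableEq β] in
/-- Membership in `covered`. [folklore] -/
private theorem mem_covered {C : Finset β} {x : V} :
    x ∈ covered s t C ↔ ∃ b ∈ C, x ∈ ends s t b := by
  simp [covered]

/-- The empty vertex set has only the empty configuration: `Z_∅ = 1`. [cite: HeilmannLieb1972, (4.19)] -/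
theorem mdSum_empty (a : V → R) (w : β → R) : mdSum s t a w ∅ = 1 := by
  unfold mdSum
  have h : dimerConfigs s t (∅ : Finset V) = {∅} := by
    ext C
    rw [mem_dimerConfigs, Finset.mem_singleton]
    constructor
    · rintro ⟨hC, -⟩
      exact Finset.subset_empty.1 (hC.trans (by intro b hb; simp [mem_bondsIn] at hb))
    · rintro rfl
      exact ⟨Finset.empty_subset _, by simp⟩
  rw [h, Finset.sum_singleton]
  simp [covered]

/-! ### The Heilmann–Lieb recursion for the monomer–dimer sum -/

/-- Configurations avoiding the vertex `z` are the configurations inside `A ∖ {z}`. [folklore] -/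
private theorem mem_dimerConfigs_erase {A : Finset V} {z : V} {C : Finset β} :
    C ∈ dimerConfigs s t (A.erase z) ↔ C ∈ dimerConfigs s t A ∧ z ∉ covered s t C := by
  rw [mem_dimerConfigs, mem_dimerConfigs, mem_covered]
  constructor
  · rintro ⟨hC, hP⟩
    refine ⟨⟨fun b hb => ?_, hP⟩, ?_⟩
    · have := mem_bondsIn.1 (hC hb)
      exact mem_bondsIn.2 ⟨Finset.mem_of_mem_erase this.1, Finset.mem_of_mem_erase this.2.1,
        this.2.2⟩
    · rintro ⟨b, hb, hzb⟩
      have := mem_bondsIn.1 (hC hb)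
      rcases mem_ends.1 hzb with rfl | rfl
      · exact (Finset.mem_erase.1 this.1).1 rfl
      · exact (Finset.mem_erase.1 this.2.1).1 rfl
  · rintro ⟨⟨hC, hP⟩, hz⟩
    refine ⟨fun b hb => ?_, hP⟩
    have := mem_bondsIn.1 (hC hb)
    have hzs : z ≠ s b := fun h => hz ⟨b, hb, mem_ends.2 (Or.inl h)⟩
    have hzt : z ≠ t b := fun h => hz ⟨b, hb, mem_ends.2 (Or.inr h)⟩
    exact mem_bondsIn.2 ⟨Finset.mem_erase.2 ⟨hzs.symm, this.1⟩,
      Finset.mem_erase.2 ⟨hzt.symm, this.2.1⟩, this.2.2⟩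

/-- Removing the dimer `b` from a configuration inside `A` gives a configuration inside `A ∖ ends b`.
[folklore] -/
private theorem erase_mem_dimerConfigs_sdiff {A : Finset V} {C : Finset β} (hC : C ∈ dimerConfigs s t A)
    {b : β} (hb : b ∈ C) : C.erase b ∈ dimerConfigs s t (A \ ends s t b) := by
  obtain ⟨hCA, hP⟩ := mem_dimerConfigs.1 hC
  refine mem_dimerConfigs.2 ⟨fun b' hb' => ?_, hP.mono (by simp)⟩
  obtain ⟨hne, hb'C⟩ := Finset.mem_erase.1 hb'
  have h' := mem_bondsIn.1 (hCA hb'C)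
  have hdis : Disjoint (ends s t b') (ends s t b) := hP hb'C hb hne
  refine mem_bondsIn.2 ⟨Finset.mem_sdiff.2 ⟨h'.1, fun h => ?_⟩,
    Finset.mem_sdiff.2 ⟨h'.2.1, fun h => ?_⟩, h'.2.2⟩
  · exact Finset.disjoint_left.1 hdis (mem_ends.2 (Or.inl rfl)) h
  · exact Finset.disjoint_left.1 hdis (mem_ends.2 (Or.inr rfl)) h

/-- Adding a dimer `b` inside `A` to a configuration inside `A ∖ ends b` gives a configuration
inside `A`. [folklore] -/
private theorem insert_mem_dimerConfigs {A : Finset V} {b : β} (hb : b ∈ bondsIn s t A)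
    {C : Finset β} (hC : C ∈ dimerConfigs s t (A \ ends s t b)) :
    insert b C ∈ dimerConfigs s t A := by
  obtain ⟨hCA, hP⟩ := mem_dimerConfigs.1 hC
  have hsub : ∀ b' ∈ C, b' ∈ bondsIn s t A ∧ Disjoint (ends s t b') (ends s t b) := by
    intro b' hb'
    have h' := mem_bondsIn.1 (hCA hb')
    refine ⟨mem_bondsIn.2 ⟨(Finset.mem_sdiff.1 h'.1).1, (Finset.mem_sdiff.1 h'.2.1).1, h'.2.2⟩, ?_⟩
    rw [Finset.disjoint_left]
    intro x hx
    rcases mem_ends.1 hx with rfl | rfl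
    · exact (Finset.mem_sdiff.1 h'.1).2
    · exact (Finset.mem_sdiff.1 h'.2.1).2
  refine mem_dimerConfigs.2 ⟨?_, ?_⟩
  · intro b' hb'
    rcases Finset.mem_insert.1 hb' with rfl | hb'
    · exact hb
    · exact (hsub b' hb').1
  · rw [Finset.coe_insert]
    exact Set.pairwise_insert.2 ⟨hP, fun b' hb' _ => ⟨(hsub b' hb').2.symm, (hsub b' hb').2⟩⟩

/-- A dimer of a configuration inside `A ∖ ends b` is not `b`. [folklore] -/
private theorem not_mem_of_mem_dimerConfigs_sdiff {A : Finset V} {b : β}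
    {C : Finset β} (hC : C ∈ dimerConfigs s t (A \ ends s t b)) : b ∉ C := by
  intro hbC
  have h' := mem_bondsIn.1 ((mem_dimerConfigs.1 hC).1 hbC)
  exact (Finset.mem_sdiff.1 h'.1).2 (mem_ends.2 (Or.inl rfl))

/-- In an allowed configuration at most one dimer covers a given vertex. [cite: SalmhoferSeiler1991, (3.6)] -/
private theorem card_filter_cover_le_one {A : Finset V} {C : Finset β} (hC : C ∈ dimerConfigs s t A)
    (z : V) : (C.filter fun b => z ∈ ends s t b).card ≤ 1 := by
  rw [Finset.card_le_one]
  intro b hb b' hb'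
  obtain ⟨hbC, hzb⟩ := Finset.mem_filter.1 hb
  obtain ⟨hb'C, hzb'⟩ := Finset.mem_filter.1 hb'
  by_contra hne
  have := (mem_dimerConfigs.1 hC).2 hbC hb'C hne
  exact Finset.disjoint_left.1 this hzb hzb'

omit [Fintype β] in
/-- The uncovered vertices after adding the dimer `b`: `A ∖ covered (b ∪ C) = (A ∖ ends b) ∖ covered C`.
[folklore] -/
private theorem sdiff_covered_insert (A : Finset V) (b : β) (C : Finset β) :
    A \ covered s t (insert b C) = (A \ ends s t b) \ covered s t C := by
  ext x
  simp only [Finset.mem_sdiff, mem_covered, Finset.mem_insert, exists_eq_or_imp, not_or,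
    not_exists, not_and]
  tauto

/-- **The monomer–dimer recursion** (Heilmann–Lieb (4.11)): for `z ∈ A`,
`Z_A = a_z Z_{A∖z} + ∑_{b proper bond of A at z} w_b Z_{A ∖ ends b}` — either `z` carries a monomer,
or it is covered by exactly one dimer `b`. [cite: HeilmannLieb1972, (4.11)][cite: SalmhoferSeiler1991, (3.7) and Thm. 3.6 ("recursion relation [20, 21]")] -/
theorem mdSum_rec (a : V → R) (w : β → R) {A : Finset V} {z : V} (hz : z ∈ A) :
    mdSum s t a w A = a z * mdSum s t a w (A.erase z) +
      ∑ b ∈ (bondsIn s t A).filter (fun b => z ∈ ends s t b), w b * mdSum s t a w (A \ ends s t b) := by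
  classical
  set F : Finset β → R := fun C => (∏ b ∈ C, w b) * ∏ x ∈ A \ covered s t C, a x with hF
  have hmd : mdSum s t a w A = ∑ C ∈ dimerConfigs s t A, F C := rfl
  -- split the configurations according to whether `z` is covered
  rw [hmd, ← Finset.sum_filter_add_sum_filter_not (dimerConfigs s t A) (fun C => z ∉ covered s t C)]
  congr 1
  · -- `z` uncovered: configurations of `A ∖ z`, with the monomer `a_z` factored out
    have hset : (dimerConfigs s t A).filter (fun C => z ∉ covered s t C) =
        dimerConfigs s t (A.erase z) := by
      ext C; rw [Finset.mem_filter, mem_dimerConfigs_erase]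
    rw [hset, mdSum, Finset.mul_sum]
    refine Finset.sum_congr rfl fun C hC => ?_
    have hzC : z ∉ covered s t C := (mem_dimerConfigs_erase.1 hC).2
    have hsplit : A \ covered s t C = insert z ((A.erase z) \ covered s t C) := by
      ext x
      simp only [Finset.mem_sdiff, Finset.mem_insert, Finset.mem_erase]
      constructor
      · rintro ⟨hxA, hxc⟩
        by_cases hxz : x = z
        · exact Or.inl hxz
        · exact Or.inr ⟨⟨hxz, hxA⟩, hxc⟩
      · rintro (rfl | ⟨⟨-, hxA⟩, hxc⟩)
        · exact ⟨hz, hzC⟩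
        · exact ⟨hxA, hxc⟩
    have hznot : z ∉ (A.erase z) \ covered s t C := by simp
    rw [hF]
    simp only
    rw [hsplit, Finset.prod_insert hznot]
    ring
  · -- `z` covered: by exactly one dimer `b`; regroup by `b`
    have hcov : ∀ C ∈ (dimerConfigs s t A).filter (fun C => ¬ z ∉ covered s t C),
        F C = ∑ b ∈ (bondsIn s t A).filter (fun b => z ∈ ends s t b),
          if b ∈ C then F C else 0 := by
      intro C hC
      obtain ⟨hCA, hzC⟩ := Finset.mem_filter.1 hC
      rw [not_not, mem_covered] at hzC
      obtain ⟨b₀, hb₀C, hzb₀⟩ := hzC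
      rw [← Finset.sum_filter]
      have hone : ((bondsIn s t A).filter (fun b => z ∈ ends s t b)).filter (fun b => b ∈ C) = {b₀} := by
        apply Finset.eq_singleton_iff_unique_mem.2
        refine ⟨Finset.mem_filter.2 ⟨Finset.mem_filter.2 ⟨(mem_dimerConfigs.1 hCA).1 hb₀C, hzb₀⟩, hb₀C⟩,
          fun b hb => ?_⟩
        obtain ⟨hb1, hbC⟩ := Finset.mem_filter.1 hb
        obtain ⟨-, hzb⟩ := Finset.mem_filter.1 hb1
        have hle := card_filter_cover_le_one hCA z
        exact Finset.card_le_one.1 hle b (Finset.mem_filter.2 ⟨hbC, hzb⟩) b₀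
          (Finset.mem_filter.2 ⟨hb₀C, hzb₀⟩)
      rw [hone, Finset.sum_singleton]
    rw [Finset.sum_congr rfl hcov, Finset.sum_comm]
    refine Finset.sum_congr rfl fun b hb => ?_
    obtain ⟨hbA, hzb⟩ := Finset.mem_filter.1 hb
    rw [Finset.sum_ite, Finset.sum_const_zero, add_zero]
    -- the configurations of `A` containing `b` ↔ the configurations of `A ∖ ends b`
    have hset : ((dimerConfigs s t A).filter (fun C => ¬ z ∉ covered s t C)).filter (fun C => b ∈ C) =
        (dimerConfigs s t (A \ ends s t b)).image (insert b) := by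
      ext C
      simp only [Finset.mem_filter, Finset.mem_image, not_not]
      constructor
      · rintro ⟨⟨hC, -⟩, hbC⟩
        exact ⟨C.erase b, erase_mem_dimerConfigs_sdiff hC hbC, Finset.insert_erase hbC⟩
      · rintro ⟨C', hC', rfl⟩
        exact ⟨⟨insert_mem_dimerConfigs hbA hC',
          mem_covered.2 ⟨b, Finset.mem_insert_self b C', hzb⟩⟩, Finset.mem_insert_self b C'⟩
    rw [hset, Finset.sum_image, mdSum, Finset.mul_sum]
    · refine Finset.sum_congr rfl fun C hC => ?_
      have hbC : b ∉ C := not_mem_of_mem_dimerConfigs_sdiff hC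
      rw [hF]
      simp only
      rw [Finset.prod_insert hbC, sdiff_covered_insert]
      ring
    · intro C hC C' hC' h
      have hbC : b ∉ C := not_mem_of_mem_dimerConfigs_sdiff hC
      have hbC' : b ∉ C' := not_mem_of_mem_dimerConfigs_sdiff hC'
      rw [← Finset.erase_insert hbC, h, Finset.erase_insert hbC']

/-! ### (3.7): the coefficient extraction at capacity one is the monomer–dimer sum -/

/-- The capacity function `𝟙_A` (one unit of capacity at each vertex of `A`). [cite: SalmhoferSeiler1991, (3.5)] -/
def capOne (A : Finset V) : V →₀ ℕ := ∑ x ∈ A, Finsupp.single x 1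

omit [Fintype β] [DecidableEq β] in
/-- `𝟙_A(x) = [x ∈ A]`. [folklore] -/
private theorem capOne_apply (A : Finset V) (x : V) : capOne A x = if x ∈ A then 1 else 0 := by
  unfold capOne
  rw [Finsupp.finsetSum_apply]
  simp_rw [Finsupp.single_apply]
  rw [Finset.sum_ite_eq']

omit [Fintype β] [DecidableEq β] in
/-- `𝟙_A ≤ 1`. [folklore] -/
private theorem capOne_le_one (A : Finset V) (x : V) : capOne A x ≤ 1 := by
  rw [capOne_apply]; split_ifs <;> simp

omit [Fintype β] [DecidableEq β] in
/-- The support of `𝟙_A` is `A`. [folklore] -/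
private theorem mem_support_capOne {A : Finset V} {x : V} : x ∈ (capOne A).support ↔ x ∈ A := by
  rw [Finsupp.mem_support_iff, capOne_apply]
  split_ifs with h <;> simp [h]

omit [Fintype β] [DecidableEq β] in
/-- Removing the unit of capacity at `z ∈ A`: `𝟙_A - δ_z = 𝟙_{A∖z}`. [folklore] -/
private theorem capOne_sub_single {A : Finset V} {z : V} (hz : z ∈ A) :
    capOne A - Finsupp.single z 1 = capOne (A.erase z) := by
  ext x
  rw [Finsupp.tsub_apply, capOne_apply, capOne_apply, Finsupp.single_apply]
  by_cases hxz : z = x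
  · subst hxz; simp [hz]
  · rw [if_neg hxz]
    have : (x ∈ A.erase z) ↔ x ∈ A := by simp [Finset.mem_erase, Ne.symm hxz]
    simp only [this, tsub_zero]

omit [DecidableEq V] [Fintype β] [DecidableEq β] in
/-- `𝟙_∅ = 0`. [folklore] -/
private theorem capOne_empty : capOne (∅ : Finset V) = 0 := by
  simp [capOne]

variable [Fintype V]

/-- `a^j/j!` are exponential Taylor data. [folklore] -/
private theorem isExpData_pow_div_factorial' {K : Type*} [Field K] [CharZero K] (a : K) :
    IsExpData a (fun j => a ^ j / (Nat.factorial j : K)) := by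
  refine ⟨by simp, fun j => ?_⟩
  have hj : ((Nat.factorial j : ℕ) : K) ≠ 0 := by exact_mod_cast (Nat.factorial_pos j).ne'
  have hj1 : ((j : K) + 1) ≠ 0 := by exact_mod_cast (Nat.succ_ne_zero j)
  show ((j : K) + 1) * (a ^ (j + 1) / ((j + 1).factorial : K)) = a * (a ^ j / (j.factorial : K))
  rw [Nat.factorial_succ, Nat.cast_mul, pow_succ]
  push_cast
  field_simp

/-- **(3.7): the contour integral at capacity one is the monomer–dimer partition function.**  For
exponential data (`F_x = e^{a_x σ}`, `B_b = e^{w_b σσ'}`, truncated at any degree `D ≥ 1`),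
`[∏_{x ∈ A} σ_x] ∏_x F_x ∏_b B_b = ∑_{C allowed in A} ∏_{b ∈ C} w_b ∏_{x ∈ A uncovered} a_x`
— "the restriction to allowed dimer configurations as well as the filling condition come from the
contour integral".  Proof: both sides obey the recursion (4.11) (`MonomerDimer.rec`, `mdSum_rec`)
with the same value `1` on the empty set. [cite: SalmhoferSeiler1991, (3.5)–(3.7)][cite: HeilmannLieb1972, (4.11)] -/
theorem Z_capOne_eq_mdSum {D : ℕ} (hD : 1 ≤ D) {f : V → ℕ → R} {g : β → ℕ → R} {a : V → R}
    {w : β → R} (hf : ∀ x, IsExpData (a x) (f x)) (hg : ∀ b, IsExpData (w b) (g b))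
    (A : Finset V) : Z D s t f g (capOne A) = mdSum s t a w A := by
  classical
  induction' hn : A.card using Nat.strong_induction_on with n ih generalizing A
  rcases A.eq_empty_or_nonempty with rfl | ⟨z, hz⟩
  · rw [capOne_empty, Z_zero (fun x => (hf x).1) (fun b => (hg b).1), mdSum_empty]
  · have hzs : z ∈ (capOne A).support := mem_support_capOne.2 hz
    have hrec := rec (s := s) (t := t) hf hg (fun x => (capOne_le_one A x).trans hD) hzs
    rw [capOne_apply, if_pos hz, Nat.cast_one, one_mul, capOne_sub_single hz] at hrec
    have hcard : 0 < A.card := Finset.card_pos.2 ⟨z, hz⟩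
    rw [hrec, mdSum_rec a w hz, ih _ (by rw [Finset.card_erase_of_mem hz]; omega) (A.erase z) rfl]
    congr 1
    -- the dimer terms: `Zdrop (𝟙_{A∖z}) y = [y ∈ A∖z] Z(𝟙_{A∖{z,y}})`
    have hdrop : ∀ y, Zdrop D s t f g (capOne (A.erase z)) y =
        if y ∈ A.erase z then mdSum s t a w ((A.erase z).erase y) else 0 := by
      intro y
      unfold Zdrop
      by_cases hy : y ∈ A.erase z
      · rw [if_pos (mem_support_capOne.2 hy), if_pos hy, capOne_sub_single hy]
        exact ih _ (by rw [Finset.card_erase_of_mem hy, Finset.card_erase_of_mem hz]; omega) _ rfl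
      · rw [if_neg (fun h => hy (mem_support_capOne.1 h)), if_neg hy]
    simp_rw [hdrop]
    -- compare the two bond sums term by term
    have hflt : (bondsIn s t A).filter (fun b => z ∈ ends s t b) =
        univ.filter (fun b => b ∈ bondsIn s t A ∧ z ∈ ends s t b) := by
      ext b; simp
    rw [hflt, Finset.sum_filter]
    refine Finset.sum_congr rfl fun b _ => ?_
    have hends : ∀ y, y ∈ A.erase z → (A.erase z).erase y = A \ ends s t b →
        mdSum s t a w ((A.erase z).erase y) = mdSum s t a w (A \ ends s t b) := fun y _ h => by rw [h]
    by_cases hs : s b = z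
    · by_cases ht : t b = z
      · -- self-bond at `z`: no dimer, and no capacity left
        have h1 : t b ∉ A.erase z := by rw [ht]; simp
        have h1' : s b ∉ A.erase z := by rw [hs]; simp
        have h2 : b ∉ bondsIn s t A := fun h => (mem_bondsIn.1 h).2.2 (hs.trans ht.symm)
        rw [if_pos hs, if_pos ht, if_neg h1, if_neg h1', if_neg (fun h => h2 h.1)]
        ring
      · by_cases htA : t b ∈ A
        · have h1 : t b ∈ A.erase z := Finset.mem_erase.2 ⟨ht, htA⟩
          have hb : b ∈ bondsIn s t A ∧ z ∈ ends s t b :=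
            ⟨mem_bondsIn.2 ⟨hs ▸ hz, htA, by rw [hs]; exact Ne.symm ht⟩, mem_ends.2 (Or.inl hs.symm)⟩
          have hset : (A.erase z).erase (t b) = A \ ends s t b := by
            ext x; simp only [Finset.mem_erase, Finset.mem_sdiff, mem_ends, hs]; tauto
          rw [if_pos hs, if_neg ht, if_pos h1, if_pos hb, hset, add_zero]
        · have h1 : t b ∉ A.erase z := fun h => htA (Finset.mem_of_mem_erase h)
          have hb : ¬ (b ∈ bondsIn s t A ∧ z ∈ ends s t b) := fun h => htA (mem_bondsIn.1 h.1).2.1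
          rw [if_pos hs, if_neg ht, if_neg h1, if_neg hb]
          ring
    · by_cases ht : t b = z
      · by_cases hsA : s b ∈ A
        · have h1 : s b ∈ A.erase z := Finset.mem_erase.2 ⟨hs, hsA⟩
          have hb : b ∈ bondsIn s t A ∧ z ∈ ends s t b :=
            ⟨mem_bondsIn.2 ⟨hsA, ht ▸ hz, by rw [ht]; exact hs⟩, mem_ends.2 (Or.inr ht.symm)⟩
          have hset : (A.erase z).erase (s b) = A \ ends s t b := by
            ext x; simp only [Finset.mem_erase, Finset.mem_sdiff, mem_ends, ht]; tauto
          rw [if_neg hs, if_pos ht, if_pos h1, if_pos hb, hset, zero_add]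
        · have h1 : s b ∉ A.erase z := fun h => hsA (Finset.mem_of_mem_erase h)
          have hb : ¬ (b ∈ bondsIn s t A ∧ z ∈ ends s t b) := fun h => hsA (mem_bondsIn.1 h.1).1
          rw [if_neg hs, if_pos ht, if_neg h1, if_neg hb]
          ring
      · have hb : ¬ (b ∈ bondsIn s t A ∧ z ∈ ends s t b) := by
          rintro ⟨-, h⟩
          rcases mem_ends.1 h with h | h
          · exact hs h.symm
          · exact ht h.symm
        rw [if_neg hs, if_neg ht, if_neg hb]
        ring

/-! ### Theorem 3.6 for weighted graphs and the real-rootedness of matching polynomials -/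

/-- **Theorem 3.6 (Salmhofer–Seiler) / Theorem 4.6 (Heilmann–Lieb), verbatim for weighted graphs.**
"Let `G` be a graph, `w_xy ≥ 0` for all bonds and `Re m_x > 0` for all `x ∈ V(G)`. Then `Z_G ≠ 0`",
`Z_G` the monomer–dimer partition function (3.7). [cite: SalmhoferSeiler1991, Thm. 3.6][cite: HeilmannLieb1972, Thm. 4.6] -/
theorem mdSum_ne_zero_of_re_pos {w : β → ℝ} (hw : ∀ b, 0 ≤ w b) {a : V → ℂ}
    (ha : ∀ x, 0 < (a x).re) (A : Finset V) :
    mdSum s t a (fun b => (w b : ℂ)) A ≠ 0 := by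
  rw [← Z_capOne_eq_mdSum (D := 1) le_rfl (fun x => isExpData_pow_div_factorial' (a x))
    (fun b => isExpData_pow_div_factorial' (w b : ℂ)) A]
  exact Z_ne_zero_of_re_pos (fun x => isExpData_pow_div_factorial' (a x))
    (fun b => isExpData_pow_div_factorial' (w b : ℂ)) ha hw _ (capOne_le_one A)

/-- **Theorem 3.6, `Re m_x < 0` for all `x`.** [cite: SalmhoferSeiler1991, Thm. 3.6][cite: HeilmannLieb1972, Thm. 4.6] -/
theorem mdSum_ne_zero_of_re_neg {w : β → ℝ} (hw : ∀ b, 0 ≤ w b) {a : V → ℂ}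
    (ha : ∀ x, (a x).re < 0) (A : Finset V) :
    mdSum s t a (fun b => (w b : ℂ)) A ≠ 0 := by
  rw [← Z_capOne_eq_mdSum (D := 1) le_rfl (fun x => isExpData_pow_div_factorial' (a x))
    (fun b => isExpData_pow_div_factorial' (w b : ℂ)) A]
  exact Z_ne_zero_of_re_neg (fun x => isExpData_pow_div_factorial' (a x))
    (fun b => isExpData_pow_div_factorial' (w b : ℂ)) ha hw _ (capOne_le_one A)

omit [DecidableEq β] in
/-- The weighted degree at capacity one is Heilmann–Lieb's `∑_j W(i,j)` (each self-bond counted with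
both ends). [cite: HeilmannLieb1972, (4.8)] -/
theorem weightedDegree_capOne_univ (w : β → ℝ) (x : V) :
    weightedDegree s t w (capOne (univ : Finset V)) x =
      ∑ b, w b * ((if s b = x then 1 else 0) + (if t b = x then 1 else 0)) := by
  unfold weightedDegree
  refine Finset.sum_congr rfl fun b _ => ?_
  rw [capOne_apply, capOne_apply, if_pos (Finset.mem_univ _), if_pos (Finset.mem_univ _)]
  push_cast
  ring

/-- **Theorem 4.3 (Heilmann–Lieb), the bound on the zeros**: if all activities have modulus
`≥ R > 0` with `R² ≥ 4 ∑_{b ∋ x} w_b` for every vertex `x` (`= 4B₁` for the maximal weighted degree),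
then `Z_G ≠ 0`; i.e. every zero has `|m| < 2√B₁` (4.10). [cite: HeilmannLieb1972, Thm. 4.3][cite: SalmhoferSeiler1991, (3.28)] -/
theorem mdSum_ne_zero_of_norm {w : β → ℝ} (hw : ∀ b, 0 ≤ w b) {a : V → ℂ} {R : ℝ} (hR : 0 < R)
    (haR : ∀ x, R ≤ ‖a x‖)
    (hW : ∀ x, 4 * ∑ b, w b * ((if s b = x then 1 else 0) + (if t b = x then 1 else 0)) ≤ R ^ 2) :
    mdSum s t a (fun b => (w b : ℂ)) (univ : Finset V) ≠ 0 := by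
  rw [← Z_capOne_eq_mdSum (D := 1) le_rfl (fun x => isExpData_pow_div_factorial' (a x))
    (fun b => isExpData_pow_div_factorial' (w b : ℂ)) univ]
  exact (heilmannLieb_rootBound (fun x => isExpData_pow_div_factorial' (a x))
    (fun b => isExpData_pow_div_factorial' (w b : ℂ)) hw hR haR _ (capOne_le_one _)
    (fun x => by rw [weightedDegree_capOne_univ]; exact hW x)).1

/-- **Heilmann–Lieb's theorem (Thms. 4.2–4.3): the zeros of the weighted matching polynomial.**  For a
finite graph with bond weights `w_b ≥ 0` and ONE activity `x` at every vertex, the monomer–dimer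
partition function `Z_G(x) = ∑_M w^M x^{|V| - 2|M|}` (the matching generating polynomial; Heilmann–Lieb's
`Q(G; x)`, whose real-rootedness is that of `P`/the matching polynomial `μ_w(G, y) = i^{-|V|} Z_G(iy)`)
vanishes only at purely imaginary `x` with `|x|² < 4 B₁`, `B₁ = max_v ∑_{b ∋ v} w_b`: all roots of the
matching polynomial are real and lie in `(-2√B₁, 2√B₁)`. [cite: HeilmannLieb1972, Thm. 4.2 and Thm. 4.3] -/
theorem mdSum_uniform_eq_zero_imp {w : β → ℝ} (hw : ∀ b, 0 ≤ w b) {x : ℂ}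
    (h0 : mdSum s t (fun _ => x) (fun b => (w b : ℂ)) (univ : Finset V) = 0) :
    x.re = 0 ∧ ∀ R : ℝ, 0 < R →
      (∀ v, 4 * ∑ b, w b * ((if s b = v then 1 else 0) + (if t b = v then 1 else 0)) ≤ R ^ 2) →
        ‖x‖ < R := by
  constructor
  · by_contra hre
    rcases lt_or_gt_of_ne hre with h | h
    · exact mdSum_ne_zero_of_re_neg hw (fun _ => h) univ h0
    · exact mdSum_ne_zero_of_re_pos hw (fun _ => h) univ h0
  · intro R hR hW
    by_contra hx
    exact mdSum_ne_zero_of_norm hw hR (fun _ => not_lt.1 hx) hW h0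

end MonomerDimer

end Literature.MathematicalPhysics.StatisticalMechanics
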